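import Literature.AnabelianGeometry.EtaleTheta.GalSectSplittingsTransport
import HarnessLib

/-!
# [GalSect] §4 / Def. 4.1: transport of STRUCTURES along an equivariant class transport (proof-only)

S. Mochizuki, *Galois sections in absolute anabelian geometry* [GalSect], Nagoya Math. J. **179** (2005), §4,
Def. 4.1 (i)–(iv) p.33–34 [cite: MochizukiGalSect2005, Def 4.1 p.33]; consumer: [EtTh] Thm. 1.10 (iii) / Cor.
2.8 (ii) "a `{±1}`-structure … preserved by `γ`" [cite: MochizukiEtTh2009, Thm 1.10 (iii) p.30].  abc-iut cell,
layer L2, seat abc-iut-w5-d062 (gen 3), row «O1-(b2) at the genuine torsor», FILE (C).  PROOF-ONLY.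

For torsor structures `T` on `P` (group `A`) and `T'` on `P'` (group `A'`), a map of classes `e` and a map of
structure groups `φ` with `e (k • c) = φ(k) • e(c)` (the equivariance PROVED for the genuine `H¹`-torsors in
FILE (B), assumed as O1's binder `hequiv` for the abstract `(K^×)^∧`-torsors):

* `TorsorData.image_orbit` — `e` carries the `B`-orbit of `c` onto the `φ(B)`-orbit of `e c`;
* `TorsorData.IsStructure.image` — the image of a `B`-structure is a `φ(B)`-structure (Def. 4.1 (i)/(ii)
  shapes are functorial); `IsSubStructure.image` — compatibly with inclusions into (canonical) structures;
* `TorsorData.IsStructure.image_of_map_eq` — with `φ(B) = B'` (e.g. `φ(μ₂) = μ₂`), a `B`-structure goes to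
  a `B'`-structure: the bookkeeping behind "the `{±1}`-structure … is preserved by `γ`", isolated from O1's
  inline argument (`thm110iiiGalSect_of_transport`) so that the 13:00Z re-typing `Thm110iiiEta` can cite it.

HONEST FRAMING: elementary; [GalSect] refereed; nothing here bears on [IUTchIII] Cor. 3.12; typed ≠ proved.
-/

namespace Literature.AnabelianGeometry.EtaleTheta

namespace GalSect

namespace CuspPair

namespace TorsorData

variable {G G' : Type*} [Group G] [TopologicalSpace G] [Group G'] [TopologicalSpace G']
  {P : CuspPair G} {P' : CuspPair G'} {A A' : Type*} [Group A] [Group A']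
  (T : P.TorsorData A) (T' : P'.TorsorData A')
  {e : P.SplittingClass → P'.SplittingClass} {φ : A →* A'}

/-- **Orbits are transported**: under an equivariant class transport, the image of the `B`-orbit of `c` is
the `φ(B)`-orbit of `e c`. [cite: MochizukiGalSect2005, Def 4.1 p.33] -/
theorem image_orbit (hequiv : ∀ (k : A) (c : P.SplittingClass), e (T.act k c) = T'.act (φ k) (e c))
    (B : Subgroup A) (c : P.SplittingClass) :
    e '' {c' | ∃ b ∈ B, c' = T.act b c} = {c' | ∃ b' ∈ B.map φ, c' = T'.act b' (e c)} := by
  ext x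
  constructor
  · rintro ⟨_, ⟨b, hb, rfl⟩, rfl⟩
    exact ⟨φ b, Subgroup.mem_map_of_mem φ hb, hequiv b c⟩
  · rintro ⟨_, ⟨b, hb, rfl⟩, rfl⟩
    exact ⟨T.act b c, ⟨b, hb, rfl⟩, hequiv b c⟩

/-- **Structures are transported** (Def. 4.1 (i)/(ii) shapes are functorial): the image of a
`B`-structure is a `φ(B)`-structure. [cite: MochizukiGalSect2005, Def 4.1 p.33] -/
theorem IsStructure.image {B : Subgroup A} {R : Set P.SplittingClass} (hR : T.IsStructure B R)
    (hequiv : ∀ (k : A) (c : P.SplittingClass), e (T.act k c) = T'.act (φ k) (e c)) :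
    T'.IsStructure (B.map φ) (e '' R) := by
  obtain ⟨c, hc, rfl⟩ := hR
  exact ⟨e c, ⟨c, hc, rfl⟩, image_orbit T T' hequiv B c⟩

/-- … with a prescribed image group: if `φ(B) = B'` then a `B`-structure goes to a `B'`-structure (e.g.
`φ(μ₂) = μ₂`: "`{±1}`-structures are preserved"). [cite: MochizukiGalSect2005, Def 4.1 p.33] -/
theorem IsStructure.image_of_map_eq {B : Subgroup A} {B' : Subgroup A'} {R : Set P.SplittingClass}
    (hR : T.IsStructure B R)
    (hequiv : ∀ (k : A) (c : P.SplittingClass), e (T.act k c) = T'.act (φ k) (e c)) (hB : B.map φ = B') :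
    T'.IsStructure B' (e '' R) :=
  hB ▸ hR.image T T' hequiv

/-- **Sub-structures are transported compatibly**: a `μ`-structure inside `Rcan` goes to a `φ(μ)`-structure
inside ANY set containing `e '' Rcan` (Def. 4.1 (iv)-style compatibility: typically `Rcan' ⊇ e '' Rcan` is the
correspondence of the canonical integral structures). [cite: MochizukiGalSect2005, Def 4.1 p.33] -/
theorem IsSubStructure.image {μ : Subgroup A} {Rcan R : Set P.SplittingClass} {Rcan' : Set P'.SplittingClass}
    (hR : T.IsSubStructure μ Rcan R)
    (hequiv : ∀ (k : A) (c : P.SplittingClass), e (T.act k c) = T'.act (φ k) (e c))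
    (hcan : e '' Rcan ⊆ Rcan') :
    T'.IsSubStructure (μ.map φ) Rcan' (e '' R) :=
  ⟨hR.1.image T T' hequiv, (Set.image_mono hR.2).trans hcan⟩

/-- … with a prescribed image group `φ(μ) = μ'`. [cite: MochizukiGalSect2005, Def 4.1 p.33] -/
theorem IsSubStructure.image_of_map_eq {μ : Subgroup A} {μ' : Subgroup A'} {Rcan R : Set P.SplittingClass}
    {Rcan' : Set P'.SplittingClass} (hR : T.IsSubStructure μ Rcan R)
    (hequiv : ∀ (k : A) (c : P.SplittingClass), e (T.act k c) = T'.act (φ k) (e c))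
    (hμ : μ.map φ = μ') (hcan : e '' Rcan ⊆ Rcan') :
    T'.IsSubStructure μ' Rcan' (e '' R) :=
  hμ ▸ hR.image T T' hequiv hcan

/-- **The structure group is determined by the structure**: the action being free, two subgroups with
the same orbit through a point are equal. [cite: MochizukiGalSect2005, Def 4.1 p.33] -/
theorem eq_of_orbit_eq (T₀ : P.TorsorData A) {B₁ B₂ : Subgroup A} (c : P.SplittingClass)
    (h : {c' | ∃ b ∈ B₁, c' = T₀.act b c} = {c' | ∃ b ∈ B₂, c' = T₀.act b c}) : B₁ = B₂ := by
  have key : ∀ {B₁ B₂ : Subgroup A},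
      {c' | ∃ b ∈ B₁, c' = T₀.act b c} = {c' | ∃ b ∈ B₂, c' = T₀.act b c} → B₁ ≤ B₂ := by
    intro B₁ B₂ h b hb
    have hmem : T₀.act b c ∈ {c' | ∃ b ∈ B₂, c' = T₀.act b c} := by
      rw [← h]; exact ⟨b, hb, rfl⟩
    obtain ⟨b₂, hb₂, heq⟩ := hmem
    have : b = b₂ := (T₀.existsUnique_act_eq c (T₀.act b c)).unique rfl heq.symm
    rw [this]; exact hb₂
  exact le_antisymm (key h) (key h.symm)

/-- Hence, under an equivariant transport, if the image of a `B`-structure is a `B'`-structure then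
`B' = φ(B)` — the structure group is transported, not chosen. [cite: MochizukiGalSect2005, Def 4.1 p.33] -/
theorem IsStructure.map_eq_of_image {B : Subgroup A} {B' : Subgroup A'} {R : Set P.SplittingClass}
    (hR : T.IsStructure B R)
    (hequiv : ∀ (k : A) (c : P.SplittingClass), e (T.act k c) = T'.act (φ k) (e c))
    (hR' : T'.IsStructure B' (e '' R)) : B.map φ = B' := by
  obtain ⟨c₁, hc₁, h₁⟩ := hR.image T T' hequiv
  exact eq_of_orbit_eq T' c₁ (h₁.symm.trans (hR'.eq_orbit_of_mem T' hc₁))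

end TorsorData

end CuspPair

end GalSect

end Literature.AnabelianGeometry.EtaleTheta
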